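import Summits.HodgeConjecture.HodgeConjecture.Theorems.F0P3cStCharTSCassHTraceKit    -- ★ p849282 KIT (LH5-p05): `doubleCoset_prod`, `doubleCoset_eq_smul_of_forall_comm`, `integral_indicator_smul_mul_char`; brings ★ `smoothTrace_twist_comp_fst`, `isLocSmooth_indicator`
import Summits.HodgeConjecture.HodgeConjecture.Theorems.F0P3cStCharTSCassHTrace       -- ★ p849326 (LH5-p05): `subgroup_gl_one_mul_comm` (`U(Φ₁)_v` is abelian)
import Literature.NumberTheory.Automorphic.JacquetRayShellAllLevels                    -- ★ p849299 ∕ p849436 (this seat) F1-G generic: `Representation.smoothTrace_indicator_shell_eq_ite_of_normalizedTwoStep`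
import Literature.NumberTheory.Automorphic.UnitaryGroupPrincipalSeriesHLattice         -- ★ `cmPrincipalSeriesH` (= `i₂(χ₂) ⊠ χ₁`, `cmPrincipalSeriesH_eq_twist_comp_fst` `rfl`)
import Literature.NumberTheory.Automorphic.SmoothInductionAdmissibleOfCocompact        -- ★ `isAdmissible_cmPrincipalSeries_of_iwasawa`
import Literature.NumberTheory.Automorphic.UnitaryGroupCMLocalIwasawa                  -- ★ `exists_borel_mul_mem_cmLocalIntegralLevel` (Iwasawa at every finite place)
import Literature.NumberTheory.Automorphic.CMPrincipalSeriesJacquetEvalOne             -- ★ `nonarchimedeanGroup_cmLocal`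
import HarnessLib

/-!
# F0 · P3c · line LH6 «StCharTS» — road (D) «DEEP-FL», brick F1-H «R2d-ALL-LEVELS FOR `i_H(χ₂ ⊠ χ₁)`»: the character of the principal series of
# `H_v = U(Φ₂)(L⁺_v) × U(Φ₁)(L⁺_v)` on EVERY `H`-shell `K_H (b, z₁) K_H`, `K_H = K_{2,n} × K₁`:
# `tr i_H(χ₂ ⊠ χ₁)(𝟙_{K_H (b,z₁) K_H}) = ν₂(K_{2,n})·#R₂·𝟙[χ₂|_{K_{2,n} ∩ T₂} = 1 ∧ χ₁|_{K₁} = 1]·ν₁(K₁)·χ₁(z₁)·δ_{B₂}^{1/2}(b)·(χ₂(b) + χa(b))`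

Cell `pub/hodgecm-mathlib`, crux H413 = `stmt-HodgeConjecture-24833` (lane `--supports … --as helper`), route HCCMUnconditional; seat LH10-p02 (g2) (free hand on line LH6's
road (D); desk F0P3b-plan (g23) DEAL «F1-H★» 2026-09-02T05:30:45Z; road owner LH6-p04 (g2); consumer LH7-p04 (g2)'s D3-ii-H `normalizedOrbitalIntegralH_eq_twoCoset`, hypothesis
`hF1H` BY SHAPE, signature 05:23:12Z).  THEOREMS ONLY, sorry-free, ★-only imports; no definition ∕ instance ∕ notation ∕ named fact.  HONEST LABEL: HC_CM is proved only modulo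
the 7 printed citations (2 remaining: hLiu418 = stmt-HodgeConjecture-24832, h413 = stmt-HodgeConjecture-24833) until rung 0 closes; count-neutral in-house structure.

THE MATHEMATICS ([Casselman1977, Thm. 5.2]; [Casselman1995, Thm. 3.3.3, Prop. 4.1.6, Lemma 7.1.1 (a)]; [BushnellHenniart2006, §4.1, §9.1]; [Rogawski1990, §12.1 pp. 171–172,
§12.7 p. 193]).  `i_H(χ₂ ⊠ χ₁) = i_{U(Φ₂)}(χ₂) ⊠ χ₁` (★ `cmPrincipalSeriesH`, `rfl`); the `H`-shell at `(b, z₁)` for `K_H = K_{2,n} × K₁` is the product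
`K_{2,n} b K_{2,n} × z₁K₁` (★ kit `doubleCoset_prod`, `U(Φ₁)_v` abelian); the character of `ρ ⊠ χ` on a product test function is the character of `ρ` on the `χ`-average
(★ `smoothTrace_twist_comp_fst`), and the `χ₁`-average of `𝟙_{z₁K₁}` is `ν₁(K₁)χ₁(z₁)` if `χ₁|_{K₁} = 1` (★ kit `integral_indicator_smul_mul_char`) and `0` otherwise (§1:
left-translate by `z₁k₀z₁⁻¹` with `χ₁(k₀) ≠ 1`); the `U(Φ₂)`-factor is ★ F1-G `Representation.smoothTrace_indicator_shell_eq_ite_of_normalizedTwoStep` at the NORMALISED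
2-step Jacquet datum of `i₂(χ₂)` (line character `χa`, quotient character `χ₂`, `dim = 2∕1`) — for `U(Φ₂)(L⁺_v)` that datum is BRICK 2 ∕ (W2-c) of LH5-p05 (g2) and enters
here BY SHAPE as hypotheses (`hfd h2 ℓ hℓ1 χa hL hQ`), together with `hiff` «`χ₂|_{K_{2,n}∩T₂} = 1 ↔ χa|_{K_{2,n}∩T₂} = 1`» (Weyl normality of the level).
* §1 `integral_indicator_smul_mul_char_eq_zero` ∕ `integral_indicator_smul_mul_char_eq_ite` — the `χ`-average of a coset indicator, both cases (generic group).
* §2 **`smoothTrace_boxChar_prodShell_eq_ite_of_normalizedTwoStep`** — GENERIC all-levels product-shell identity (the kit's ★ `smoothTrace_boxChar_prodShell_eq` with the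
  depth neighbourhood replaced by the all-levels 2-step form and the `χ|_{K₁} ≠ 1` case folded into the `if`).
* §3 **`smoothTrace_cmPrincipalSeriesH_indicator_shell_eq_ite`** — the `H_v` instance = LH7-p04's `hF1H` with `A := ν₂(K_{2,n})·#R₂·ν₁(K₁)·δ_{B₂}^{1/2}(b)`, `b₁ := b`,
  `κ·χ₂(b₂) := χa(b)` (`= χ₂(bʷ)` by the rank-one Weyl conjugation, LH5-p05's W2-a), measure `ν₂ ⊗ ν₁`.

## References
* [Casselman1977] W. Casselman, *Characters and Jacquet modules*, Math. Ann. 230 (1977), Thm. 5.2.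
* [Casselman1995] W. Casselman, *Introduction to the theory of admissible representations of p-adic reductive groups* (1995 notes): Thm. 3.3.3, Prop. 4.1.6, Lemma 7.1.1 (a).
* [BushnellHenniart2006] C. J. Bushnell, G. Henniart, *The Local Langlands Conjecture for GL(2)*, Grundlehren 335 (2006), §4.1, §9.1.
* [Rogawski1990] J. D. Rogawski, *Automorphic Representations of Unitary Groups in Three Variables*, Ann. of Math. Stud. 123 (1990): §12.1 pp. 171–172; §12.7 p. 193.
-/

set_option autoImplicit false
-- the mandated namespace has the single-problem summit's repeated segment (`HodgeConjecture.HodgeConjecture`)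
set_option linter.dupNamespace false

noncomputable section

open NumberField IsDedekindDomain MeasureTheory Topology
open scoped Matrix MatrixGroups Pointwise
open Literature.NumberTheory Literature.NumberTheory.Automorphic Literature.NumberTheory.Automorphic.UnitaryGroup
open Literature.NumberTheory.GaloisRepresentations
open Literature.NumberTheory.Rogawski1990

namespace Summit.HodgeConjecture.HodgeConjecture.Cruxes.H413.F0P3cStCharTSShellTracePSH

open F0P3cStCharTSCassHTraceKit

/-! ## §1 Generic measure theory: the `χ`-average of a coset indicator when `χ|_K ≠ 1` -/

section Measure

variable {G : Type*} [Group G] [MeasurableSpace G]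

/-- **`∫ 𝟙_{zK}(u) χ(u) dμ = 0` when `χ` is NOT trivial on `K`** (left-invariant `μ`, measurable subgroup `K`): left translation by `g₀ = z k₀ z⁻¹` (`k₀ ∈ K`,
`χ(k₀) ≠ 1`) preserves `zK` and multiplies the integral by `χ(g₀) = χ(k₀) ≠ 1`. [cite: BushnellHenniart2006, §4.1] -/
theorem integral_indicator_smul_mul_char_eq_zero [MeasurableMul G] (μ : Measure G) [μ.IsMulLeftInvariant] (K : Subgroup G)
    (χ : G →* ℂˣ) {k₀ : G} (hk₀ : k₀ ∈ K) (hχ : χ k₀ ≠ 1) (z : G) :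
    ∫ u, (z • (K : Set G)).indicator (fun _ => (1 : ℂ)) u * ((χ u : ℂˣ) : ℂ) ∂μ = 0 := by
  set I : ℂ := ∫ u, (z • (K : Set G)).indicator (fun _ => (1 : ℂ)) u * ((χ u : ℂˣ) : ℂ) ∂μ with hI
  -- the coset `zK` is stable under left multiplication by `g₀ := z k₀ z⁻¹`
  have hmem : ∀ u, z * k₀ * z⁻¹ * u ∈ z • (K : Set G) ↔ u ∈ z • (K : Set G) := fun u => by
    rw [Set.mem_smul_set_iff_inv_smul_mem, Set.mem_smul_set_iff_inv_smul_mem, smul_eq_mul, smul_eq_mul,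
      show z⁻¹ * (z * k₀ * z⁻¹ * u) = k₀ * (z⁻¹ * u) by group, SetLike.mem_coe, SetLike.mem_coe, Subgroup.mul_mem_cancel_left K hk₀]
  have hind : ∀ u, (z • (K : Set G)).indicator (fun _ => (1 : ℂ)) (z * k₀ * z⁻¹ * u) = (z • (K : Set G)).indicator (fun _ => (1 : ℂ)) u := fun u => by
    by_cases hu : u ∈ z • (K : Set G)
    · rw [Set.indicator_of_mem hu, Set.indicator_of_mem ((hmem u).2 hu)]
    · rw [Set.indicator_of_notMem hu, Set.indicator_of_notMem (fun h => hu ((hmem u).1 h))]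
  -- `χ(g₀) = χ(k₀)` (values commute)
  have hχg : χ (z * k₀ * z⁻¹) = χ k₀ := by rw [map_mul, map_mul, map_inv, mul_comm (χ z) (χ k₀), mul_inv_cancel_right]
  -- `I = χ(g₀) · I`
  have hI' : I = ((χ k₀ : ℂˣ) : ℂ) * I := by
    have h := integral_mul_left_eq_self (fun u => (z • (K : Set G)).indicator (fun _ => (1 : ℂ)) u * ((χ u : ℂˣ) : ℂ)) (z * k₀ * z⁻¹) (μ := μ)
    rw [← hI] at h
    have hpt : ∀ u, (z • (K : Set G)).indicator (fun _ => (1 : ℂ)) (z * k₀ * z⁻¹ * u) * ((χ (z * k₀ * z⁻¹ * u) : ℂˣ) : ℂ) =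
        ((χ k₀ : ℂˣ) : ℂ) * ((z • (K : Set G)).indicator (fun _ => (1 : ℂ)) u * ((χ u : ℂˣ) : ℂ)) := fun u => by
      rw [hind u, map_mul, hχg, Units.val_mul]; ring
    calc I = ∫ u, (z • (K : Set G)).indicator (fun _ => (1 : ℂ)) (z * k₀ * z⁻¹ * u) * ((χ (z * k₀ * z⁻¹ * u) : ℂˣ) : ℂ) ∂μ := h.symm
      _ = ∫ u, ((χ k₀ : ℂˣ) : ℂ) * ((z • (K : Set G)).indicator (fun _ => (1 : ℂ)) u * ((χ u : ℂˣ) : ℂ)) ∂μ :=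
          integral_congr_ae (Filter.Eventually.of_forall hpt)
      _ = ((χ k₀ : ℂˣ) : ℂ) * I := by rw [integral_const_mul, hI]
  have hne : ((χ k₀ : ℂˣ) : ℂ) ≠ 1 := fun h => hχ (Units.val_eq_one.mp h)
  have h0 : (1 - ((χ k₀ : ℂˣ) : ℂ)) * I = 0 := by rw [sub_mul, one_mul, ← hI', sub_self]
  rcases mul_eq_zero.mp h0 with h | h
  · exact absurd (sub_eq_zero.mp h).symm hne
  · exact h

/-- **The `χ`-average of `𝟙_{zK}`, both cases**: `∫ 𝟙_{zK} χ dμ = if χ|_K = 1 then μ(K)·χ(z) else 0` (★ kit `integral_indicator_smul_mul_char` + the previous lemma).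
[cite: BushnellHenniart2006, §4.1] -/
theorem integral_indicator_smul_mul_char_eq_ite [MeasurableMul G] (μ : Measure G) [μ.IsMulLeftInvariant] (K : Subgroup G)
    (hKm : MeasurableSet (K : Set G)) (χ : G →* ℂˣ) (z : G) [Decidable (∀ k ∈ K, χ k = 1)] :
    ∫ u, (z • (K : Set G)).indicator (fun _ => (1 : ℂ)) u * ((χ u : ℂˣ) : ℂ) ∂μ =
      if (∀ k ∈ K, χ k = 1) then (μ.real (K : Set G) : ℂ) * ((χ z : ℂˣ) : ℂ) else 0 := by
  split_ifs with h
  · exact integral_indicator_smul_mul_char μ K hKm χ h z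
  · push Not at h
    obtain ⟨k₀, hk₀, hχ⟩ := h
    exact integral_indicator_smul_mul_char_eq_zero μ K χ hk₀ hχ z

end Measure

/-! ## §2 Generic: the character of `ρ ⊠ χ` on a product shell `(K_n b K_n) ×ˢ (z₁ K₁)` AT EVERY LEVEL, normalised 2-step Jacquet datum -/

section BoxShell

universe u

variable {G G₁ : Type u} [Group G] [TopologicalSpace G] [NonarchimedeanGroup G] [Group G₁] [TopologicalSpace G₁] [NonarchimedeanGroup G₁]
  [LocallyCompactSpace G] [LocallyCompactSpace G₁] [T2Space G] [T2Space G₁] [SecondCountableTopology G] [SecondCountableTopology G₁]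
  [MeasurableSpace G] [BorelSpace G] [MeasurableSpace G₁] [BorelSpace G₁]
  {V : Type*} [AddCommGroup V] [Module ℂ V] {ρ : Representation ℂ G V}

open scoped Classical in
/-- **`Tr (ρ ⊠ χ)(𝟙_{(K_n b K_n) × (z₁ K₁)}) = μ(K_n)·#R·(if χb|_{K_n∩M} = 1 ∧ χ|_{K₁} = 1 then μ₁(K₁)χ(z₁)·δ_P^{1/2}(b)·(χb(b) + χa(b)) else 0)` AT EVERY LEVEL** —
`ρ` admissible on `G`, `χ` a character of `G₁` with open kernel, `t = (P, M, N)` (`P`, `N` closed) with Iwahori datum `𝓘`, the NORMALISED Jacquet module of `ρ`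
two-dimensional with an `M`-line `L` of character `χa` and quotient character `χb`, `n` a level with `χb|_{K_n∩M} = 1 ↔ χa|_{K_n∩M} = 1`, `b ∈ M` central in `M`
and dominant at level `n`, `R` a left transversal of `K_n ∕ (K_n ∩ bK_nb⁻¹)`, `K₁ ≤ G₁` compact open, `z₁ ∈ G₁`.  (★ `smoothTrace_twist_comp_fst`; §1; ★ F1-G
`Representation.smoothTrace_indicator_shell_eq_ite_of_normalizedTwoStep`.)  The kit's ★ `smoothTrace_boxChar_prodShell_eq` is the deep-level special case.
[cite: Casselman1977, Thm. 5.2] [cite: Casselman1995, Thm. 3.3.3, Prop. 4.1.6] [cite: BushnellHenniart2006, §9.1] -/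
theorem smoothTrace_boxChar_prodShell_eq_ite_of_normalizedTwoStep (hadm : ρ.IsAdmissible) (χ : G₁ →* ℂˣ)
    (hχo : IsOpen ((χ.ker : Subgroup G₁) : Set G₁))
    (μ : Measure G) [μ.IsMulLeftInvariant] [IsFiniteMeasureOnCompacts μ] [SigmaFinite μ]
    (μ₁ : Measure G₁) [μ₁.IsMulLeftInvariant] [IsFiniteMeasureOnCompacts μ₁] [SigmaFinite μ₁]
    (t : ParabolicTriple G) [LocallyCompactSpace ↥t.P] (hP : IsClosed (t.P : Set G)) (hN : IsClosed (t.N : Set G)) (𝓘 : t.IwahoriDatum) (n : ℕ)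
    (hfd : FiniteDimensional ℂ (t.restrict ρ).Coinvariants) (h2 : Module.finrank ℂ (t.restrict ρ).Coinvariants = 2)
    (Lsub : Submodule ℂ (t.restrict ρ).Coinvariants) (hL1 : Module.finrank ℂ Lsub = 1) (χa χb : ↥t.M →* ℂˣ)
    (hL : ∀ (m : ↥t.M), ∀ x ∈ Lsub, ρ.normalizedJacquet t m x = ((χa m : ℂˣ) : ℂ) • x)
    (hQ : ∀ (m : ↥t.M) (x : (t.restrict ρ).Coinvariants), ρ.normalizedJacquet t m x - ((χb m : ℂˣ) : ℂ) • x ∈ Lsub)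
    (hiff : (∀ k : ↥t.M, (k : G) ∈ 𝓘.K n → χb k = 1) ↔ (∀ k : ↥t.M, (k : G) ∈ 𝓘.K n → χa k = 1))
    {b : G} (hbM : b ∈ t.M) (hbcomm : ∀ m ∈ t.M, m * b = b * m) (hbN : ∀ x ∈ 𝓘.K n ⊓ t.N, b * x * b⁻¹ ∈ 𝓘.K n)
    (hbNbar : ∀ x ∈ 𝓘.K n ⊓ 𝓘.Nbar, b⁻¹ * x * b ∈ 𝓘.K n ⊓ 𝓘.Nbar)
    (hbexh : ∀ x ∈ t.N, ∃ m : ℕ, ∀ m', m ≤ m' → b ^ m' * x * (b ^ m')⁻¹ ∈ 𝓘.K n)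
    {R : Finset G} (hR : IsLeftTransversal (𝓘.K n) (𝓘.K n ⊓ ConjAct.toConjAct b • 𝓘.K n) R)
    (K₁ : Subgroup G₁) (hK₁o : IsOpen (K₁ : Set G₁)) (hK₁c : IsCompact (K₁ : Set G₁)) (z₁ : G₁) :
    (Representation.twist (ρ.comp (MonoidHom.fst G G₁)) (χ.comp (MonoidHom.snd G G₁))).smoothTrace (μ.prod μ₁)
        ((DoubleCoset.doubleCoset b (𝓘.K n : Set G) (𝓘.K n) ×ˢ (z₁ • (K₁ : Set G₁))).indicator fun _ => (1 : ℂ)) =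
      (μ.real (𝓘.K n : Set G) : ℂ) * (R.card : ℂ) *
        (if (∀ k : ↥t.M, (k : G) ∈ 𝓘.K n → χb k = 1) ∧ (∀ k ∈ K₁, χ k = 1) then
          ((μ₁.real (K₁ : Set G₁) : ℂ) * ((χ z₁ : ℂˣ) : ℂ)) *
            (((rootDeltaChar t.P (Subgroup.inclusion t.M_le ⟨b, hbM⟩) : ℂˣ) : ℂ) * (((χb ⟨b, hbM⟩ : ℂˣ) : ℂ) + ((χa ⟨b, hbM⟩ : ℂˣ) : ℂ)))
        else 0) := by
  -- the two factors of the shell: compact open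
  have hS₂o : IsOpen (DoubleCoset.doubleCoset b (𝓘.K n : Set G) (𝓘.K n)) := by
    unfold DoubleCoset.doubleCoset; exact (𝓘.isOpen_K n).mul_left
  have hS₂c : IsCompact (DoubleCoset.doubleCoset b (𝓘.K n : Set G) (𝓘.K n)) := ((𝓘.isCompact_K n).mul isCompact_singleton).mul (𝓘.isCompact_K n)
  have hS₁o : IsOpen (z₁ • (K₁ : Set G₁)) := hK₁o.smul z₁
  have hS₁c : IsCompact (z₁ • (K₁ : Set G₁)) := hK₁c.smul z₁
  have hSc : IsCompact (DoubleCoset.doubleCoset b (𝓘.K n : Set G) (𝓘.K n) ×ˢ (z₁ • (K₁ : Set G₁))) := hS₂c.prod hS₁c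
  have hf : IsLocSmooth ((DoubleCoset.doubleCoset b (𝓘.K n : Set G) (𝓘.K n) ×ˢ (z₁ • (K₁ : Set G₁))).indicator fun _ => (1 : ℂ)) :=
    isLocSmooth_indicator (hS₂o.prod hS₁o) hSc.isClosed hSc
  have hf₂ : IsLocSmooth ((DoubleCoset.doubleCoset b (𝓘.K n : Set G) (𝓘.K n)).indicator fun _ => (1 : ℂ)) :=
    isLocSmooth_indicator hS₂o hS₂c.isClosed hS₂c
  rw [smoothTrace_twist_comp_fst ρ χ hadm hχo μ μ₁ hf.1 hf.2]
  -- the `χ`-average of the product indicator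
  have havg : (fun g : G => ∫ u, ((DoubleCoset.doubleCoset b (𝓘.K n : Set G) (𝓘.K n) ×ˢ (z₁ • (K₁ : Set G₁))).indicator (fun _ => (1 : ℂ)) (g, u)) *
      ((χ u : ℂˣ) : ℂ) ∂μ₁) =
      (if (∀ k ∈ K₁, χ k = 1) then (μ₁.real (K₁ : Set G₁) : ℂ) * ((χ z₁ : ℂˣ) : ℂ) else 0) •
        ((DoubleCoset.doubleCoset b (𝓘.K n : Set G) (𝓘.K n)).indicator fun _ => (1 : ℂ)) := by
    funext g
    have hpt : ∀ u : G₁, ((DoubleCoset.doubleCoset b (𝓘.K n : Set G) (𝓘.K n) ×ˢ (z₁ • (K₁ : Set G₁))).indicator (fun _ => (1 : ℂ)) (g, u)) *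
        ((χ u : ℂˣ) : ℂ) =
        ((DoubleCoset.doubleCoset b (𝓘.K n : Set G) (𝓘.K n)).indicator (fun _ => (1 : ℂ)) g) *
          ((z₁ • (K₁ : Set G₁)).indicator (fun _ => (1 : ℂ)) u * ((χ u : ℂˣ) : ℂ)) := by
      intro u
      rw [← mul_assoc]
      congr 1
      exact Set.indicator_prod_one
    simp_rw [hpt]
    rw [integral_const_mul, integral_indicator_smul_mul_char_eq_ite μ₁ K₁ hK₁o.measurableSet χ z₁, Pi.smul_apply, smul_eq_mul, mul_comm]
  rw [havg, ρ.smoothTrace_smul_of_mem μ hadm _ ⟨hf₂.1, hf₂.2⟩,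
    Representation.smoothTrace_indicator_shell_eq_ite_of_normalizedTwoStep μ hadm t hP hN 𝓘 n hfd h2 Lsub hL1 χa χb hL hQ hiff hbM hbcomm
      hbN hbNbar hbexh hR]
  by_cases hA : ∀ k : ↥t.M, (k : G) ∈ 𝓘.K n → χb k = 1
  · by_cases hB : ∀ k ∈ K₁, χ k = 1
    · rw [if_pos hB, if_pos hA, if_pos (And.intro hA hB)]; ring
    · have hAB : ¬ ((∀ k : ↥t.M, (k : G) ∈ 𝓘.K n → χb k = 1) ∧ (∀ k ∈ K₁, χ k = 1)) := fun h => hB h.2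
      rw [if_neg hB, if_neg hAB]; ring
  · have hAB : ¬ ((∀ k : ↥t.M, (k : G) ∈ 𝓘.K n → χb k = 1) ∧ (∀ k ∈ K₁, χ k = 1)) := fun h => hA h.1
    rw [if_neg hA, if_neg hAB]; ring

end BoxShell

/-! ## §3 The `H_v = U(Φ₂)(L⁺_v) × U(Φ₁)(L⁺_v)` instance: `tr i_H(χ₂ ⊠ χ₁)` on every `H`-shell -/

section CM

variable (L : Type) [Field L] [NumberField L] [IsCMField L] (v : HeightOneSpectrum (𝓞 ↥(maximalRealSubfield L)))
  [MeasurableSpace ((cmDatum L 2 (Matrix.of fun i j : Fin 2 => if i.val + j.val + 1 = 2 then (1 : L) else 0)).Local v)]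
  [BorelSpace ((cmDatum L 2 (Matrix.of fun i j : Fin 2 => if i.val + j.val + 1 = 2 then (1 : L) else 0)).Local v)]
  [MeasurableSpace ((cmDatum L 1 (Matrix.of fun i j : Fin 1 => if i.val + j.val + 1 = 1 then (1 : L) else 0)).Local v)]
  [BorelSpace ((cmDatum L 1 (Matrix.of fun i j : Fin 1 => if i.val + j.val + 1 = 1 then (1 : L) else 0)).Local v)]

open scoped Classical in
set_option maxHeartbeats 4000000 in  -- statement-level `whnf` on the CM carriers (measured class, ★ `F0P3cStCharTSCassHTrace`)
set_option synthInstance.maxHeartbeats 400000 in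
/-- **F1-H «R2d-ALL-LEVELS FOR `i_H(χ₂ ⊠ χ₁)`».**  At a finite place `v` of `L⁺` (non-splitness enters only through the Jacquet datum supplied by the consumer), with Haar measures `ν₂` on `U(Φ₂)(L⁺_v)` and `ν₁` on `U(Φ₁)(L⁺_v)`, for a character
`χ₂` of the torus `T₂ ≤ U(Φ₂)(L⁺_v)`, a character `χ₁` of `U(Φ₁)(L⁺_v)` with open kernel, an Iwahori datum `𝓘₂` of `B₂`, a level `n`, a torus element `b` dominant at
level `n` (shapes of ★ R2d), a left transversal `R₂` of `K_{2,n} ∕ (K_{2,n} ∩ bK_{2,n}b⁻¹)`, a compact open `K₁ ≤ U(Φ₁)(L⁺_v)` and `z₁ ∈ U(Φ₁)(L⁺_v)` — GIVEN the normalised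
2-step Jacquet datum of `i₂(χ₂) = cmPrincipalSeries L 2 v χ₂` BY SHAPE (`dim r_{B₂}(i₂(χ₂)) = 2`, a `T₂`-line `ℓ` of character `χa`, quotient character `χ₂`; LH5-p05's
BRICK 2 ∕ (W2-c)) and «`χ₂|_{K_{2,n}∩T₂} = 1 ↔ χa|_{K_{2,n}∩T₂} = 1`» (`hiff`):
`tr i_H(χ₂ ⊠ χ₁)(𝟙_{K_H (b,z₁) K_H}; ν₂ ⊗ ν₁) = ν₂(K_{2,n})·#R₂·(if χ₂|_{K_{2,n}∩T₂} = 1 ∧ χ₁|_{K₁} = 1 then ν₁(K₁)·χ₁(z₁)·δ_{B₂}^{1/2}(b)·(χ₂(b) + χa(b)) else 0)`,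
`K_H = K_{2,n} × K₁`.  (§2 at `G = U(Φ₂)_v`, `G₁ = U(Φ₁)_v` — `i_H(χ₂ ⊠ χ₁) = i₂(χ₂) ⊠ χ₁` is `rfl`; the `H`-shell is `K_{2,n} b K_{2,n} × z₁K₁` by ★ kit `doubleCoset_prod`
and `U(Φ₁)_v` abelian; admissibility ★ `isAdmissible_cmPrincipalSeries_of_iwasawa`; `B₂` closed ★ `isClosed_borelU`; `N₂` closed; `T₂` abelian ★ `torusU_mul_comm`.)
= LH7-p04 (g2)'s `hF1H` with `A := ν₂(K_{2,n})·#R₂·ν₁(K₁)·δ_{B₂}^{1/2}(b)`, `b₁ := b`, `κ·χ₂(b₂) := χa(b)`.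
[cite: Casselman1977, Thm. 5.2] [cite: Casselman1995, Thm. 3.3.3, Prop. 4.1.6, Lemma 7.1.1 (a)] [cite: Rogawski1990, §12.1 pp. 171–172; §12.7 p. 193]
[cite: BushnellHenniart2006, §9.1] -/
theorem smoothTrace_cmPrincipalSeriesH_indicator_shell_eq_ite
    (ν₂ : Measure ((cmDatum L 2 (Matrix.of fun i j : Fin 2 => if i.val + j.val + 1 = 2 then (1 : L) else 0)).Local v))
    [ν₂.IsHaarMeasure]
    (ν₁ : Measure ((cmDatum L 1 (Matrix.of fun i j : Fin 1 => if i.val + j.val + 1 = 1 then (1 : L) else 0)).Local v))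
    [ν₁.IsHaarMeasure]
    (χ₂ : ↥(torusU (conjLocal L (IsCMField.complexConj L) v) (cmLocalForm L 2 v)) →* ℂˣ)
    (χ₁ : (cmDatum L 1 (Matrix.of fun i j : Fin 1 => if i.val + j.val + 1 = 1 then (1 : L) else 0)).Local v →* ℂˣ)
    (hχ₁ : IsOpen ((χ₁.ker : Subgroup ((cmDatum L 1 (Matrix.of fun i j : Fin 1 => if i.val + j.val + 1 = 1 then (1 : L) else 0)).Local v)) :
      Set ((cmDatum L 1 (Matrix.of fun i j : Fin 1 => if i.val + j.val + 1 = 1 then (1 : L) else 0)).Local v)))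
    (𝓘₂ : (cmBorelTriple L 2 v).IwahoriDatum) (n : ℕ)
    {b : ↥(unitaryGroupOfForm (conjLocal L (IsCMField.complexConj L) v) (cmLocalForm L 2 v))} (hbM : b ∈ (cmBorelTriple L 2 v).M)
    (hbN : ∀ x ∈ 𝓘₂.K n ⊓ (cmBorelTriple L 2 v).N, b * x * b⁻¹ ∈ 𝓘₂.K n)
    (hbNbar : ∀ x ∈ 𝓘₂.K n ⊓ 𝓘₂.Nbar, b⁻¹ * x * b ∈ 𝓘₂.K n ⊓ 𝓘₂.Nbar)
    (hbexh : ∀ x ∈ (cmBorelTriple L 2 v).N, ∃ m : ℕ, ∀ m', m ≤ m' → b ^ m' * x * (b ^ m')⁻¹ ∈ 𝓘₂.K n)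
    {R₂ : Finset ↥(unitaryGroupOfForm (conjLocal L (IsCMField.complexConj L) v) (cmLocalForm L 2 v))}
    (hR₂ : IsLeftTransversal (𝓘₂.K n) (𝓘₂.K n ⊓ ConjAct.toConjAct b • 𝓘₂.K n) R₂)
    (K₁ : Subgroup ((cmDatum L 1 (Matrix.of fun i j : Fin 1 => if i.val + j.val + 1 = 1 then (1 : L) else 0)).Local v))
    (hK₁o : IsOpen (K₁ : Set ((cmDatum L 1 (Matrix.of fun i j : Fin 1 => if i.val + j.val + 1 = 1 then (1 : L) else 0)).Local v)))
    (hK₁c : IsCompact (K₁ : Set ((cmDatum L 1 (Matrix.of fun i j : Fin 1 => if i.val + j.val + 1 = 1 then (1 : L) else 0)).Local v)))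
    (z₁ : (cmDatum L 1 (Matrix.of fun i j : Fin 1 => if i.val + j.val + 1 = 1 then (1 : L) else 0)).Local v) :
    haveI := locallyCompactSpace_cmBorelU L 2 v
    ∀ (hfd : FiniteDimensional ℂ ((cmBorelTriple L 2 v).restrict (cmPrincipalSeries L 2 v χ₂)).Coinvariants)
      (h2 : Module.finrank ℂ ((cmBorelTriple L 2 v).restrict (cmPrincipalSeries L 2 v χ₂)).Coinvariants = 2)
      (ℓ : Submodule ℂ ((cmBorelTriple L 2 v).restrict (cmPrincipalSeries L 2 v χ₂)).Coinvariants) (hℓ1 : Module.finrank ℂ ℓ = 1)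
      (χa : ↥(torusU (conjLocal L (IsCMField.complexConj L) v) (cmLocalForm L 2 v)) →* ℂˣ)
      (hL : ∀ (m : ↥(cmBorelTriple L 2 v).M), ∀ x ∈ ℓ, (cmPrincipalSeries L 2 v χ₂).normalizedJacquet (cmBorelTriple L 2 v) m x = ((χa m : ℂˣ) : ℂ) • x)
      (hQ : ∀ (m : ↥(cmBorelTriple L 2 v).M) (x : ((cmBorelTriple L 2 v).restrict (cmPrincipalSeries L 2 v χ₂)).Coinvariants),
        (cmPrincipalSeries L 2 v χ₂).normalizedJacquet (cmBorelTriple L 2 v) m x - ((χ₂ m : ℂˣ) : ℂ) • x ∈ ℓ)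
      (hiff : (∀ k : ↥(cmBorelTriple L 2 v).M, (k : ↥(unitaryGroupOfForm (conjLocal L (IsCMField.complexConj L) v) (cmLocalForm L 2 v))) ∈ 𝓘₂.K n → χ₂ k = 1) ↔
        (∀ k : ↥(cmBorelTriple L 2 v).M, (k : ↥(unitaryGroupOfForm (conjLocal L (IsCMField.complexConj L) v) (cmLocalForm L 2 v))) ∈ 𝓘₂.K n → χa k = 1)),
    (cmPrincipalSeriesH L v χ₂ χ₁).smoothTrace (ν₂.prod ν₁)
        ((DoubleCoset.doubleCoset
            ((b, z₁) : ↥(unitaryGroupOfForm (conjLocal L (IsCMField.complexConj L) v) (cmLocalForm L 2 v)) ×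
              (cmDatum L 1 (Matrix.of fun i j : Fin 1 => if i.val + j.val + 1 = 1 then (1 : L) else 0)).Local v)
            (((𝓘₂.K n).prod K₁ : Subgroup (↥(unitaryGroupOfForm (conjLocal L (IsCMField.complexConj L) v) (cmLocalForm L 2 v)) ×
              (cmDatum L 1 (Matrix.of fun i j : Fin 1 => if i.val + j.val + 1 = 1 then (1 : L) else 0)).Local v)) :
                Set (↥(unitaryGroupOfForm (conjLocal L (IsCMField.complexConj L) v) (cmLocalForm L 2 v)) ×
                  (cmDatum L 1 (Matrix.of fun i j : Fin 1 => if i.val + j.val + 1 = 1 then (1 : L) else 0)).Local v))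
            (((𝓘₂.K n).prod K₁ : Subgroup (↥(unitaryGroupOfForm (conjLocal L (IsCMField.complexConj L) v) (cmLocalForm L 2 v)) ×
              (cmDatum L 1 (Matrix.of fun i j : Fin 1 => if i.val + j.val + 1 = 1 then (1 : L) else 0)).Local v)) :
                Set (↥(unitaryGroupOfForm (conjLocal L (IsCMField.complexConj L) v) (cmLocalForm L 2 v)) ×
                  (cmDatum L 1 (Matrix.of fun i j : Fin 1 => if i.val + j.val + 1 = 1 then (1 : L) else 0)).Local v))).indicator
          fun _ => (1 : ℂ)) =
      (ν₂.real (𝓘₂.K n : Set ↥(unitaryGroupOfForm (conjLocal L (IsCMField.complexConj L) v) (cmLocalForm L 2 v))) : ℂ) * (R₂.card : ℂ) *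
        (if (∀ k : ↥(cmBorelTriple L 2 v).M, (k : ↥(unitaryGroupOfForm (conjLocal L (IsCMField.complexConj L) v) (cmLocalForm L 2 v))) ∈ 𝓘₂.K n → χ₂ k = 1) ∧
              (∀ k ∈ K₁, χ₁ k = 1) then
          ((ν₁.real (K₁ : Set ((cmDatum L 1 (Matrix.of fun i j : Fin 1 => if i.val + j.val + 1 = 1 then (1 : L) else 0)).Local v)) : ℂ) *
              ((χ₁ z₁ : ℂˣ) : ℂ)) *
            (((rootDeltaChar (cmBorelTriple L 2 v).P (Subgroup.inclusion (cmBorelTriple L 2 v).M_le ⟨b, hbM⟩) : ℂˣ) : ℂ) *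
              (((χ₂ ⟨b, hbM⟩ : ℂˣ) : ℂ) + ((χa ⟨b, hbM⟩ : ℂˣ) : ℂ)))
        else 0) := by
  intro hfd h2 ℓ hℓ1 χa hL hQ hiff
  -- §0 instances: the `U(Φ₂)`-factor in its `unitaryGroupOfForm` spelling (the spelling of `cmBorelTriple`∕`𝓘₂`), and `U(Φ₁)_v` (as in ★ `F0P3cStCharTSCassHTrace`)
  letI iM2 : MeasurableSpace ↥(unitaryGroupOfForm (conjLocal L (IsCMField.complexConj L) v) (cmLocalForm L 2 v)) :=
    ‹MeasurableSpace ((cmDatum L 2 (Matrix.of fun i j : Fin 2 => if i.val + j.val + 1 = 2 then (1 : L) else 0)).Local v)›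
  haveI iB2 : BorelSpace ↥(unitaryGroupOfForm (conjLocal L (IsCMField.complexConj L) v) (cmLocalForm L 2 v)) :=
    ‹BorelSpace ((cmDatum L 2 (Matrix.of fun i j : Fin 2 => if i.val + j.val + 1 = 2 then (1 : L) else 0)).Local v)›
  haveI : LocallyCompactSpace ↥(unitaryGroupOfForm (conjLocal L (IsCMField.complexConj L) v) (cmLocalForm L 2 v)) :=
    locallyCompactSpace_local (IsCMField.complexConj L) 2 _ v
  haveI : SecondCountableTopology ↥(unitaryGroupOfForm (conjLocal L (IsCMField.complexConj L) v) (cmLocalForm L 2 v)) :=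
    secondCountableTopology_local (IsCMField.complexConj L) 2 _ v
  haveI : T2Space ↥(unitaryGroupOfForm (conjLocal L (IsCMField.complexConj L) v) (cmLocalForm L 2 v)) :=
    t2Space_cmDatum_local 2 L (Matrix.of fun i j : Fin 2 => if i.val + j.val + 1 = 2 then (1 : L) else 0) v
  haveI := nonarchimedeanGroup_cmLocal L 2 v
  haveI : NonarchimedeanGroup ((cmDatum L 1 (Matrix.of fun i j : Fin 1 => if i.val + j.val + 1 = 1 then (1 : L) else 0)).Local v) :=
    nonarchimedeanGroup_cmLocal L 1 v
  haveI iH2 : @MeasureTheory.Measure.IsHaarMeasure ↥(unitaryGroupOfForm (conjLocal L (IsCMField.complexConj L) v) (cmLocalForm L 2 v)) _ _ iM2 ν₂ :=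
    ‹ν₂.IsHaarMeasure›
  haveI : SigmaCompactSpace ↥(unitaryGroupOfForm (conjLocal L (IsCMField.complexConj L) v) (cmLocalForm L 2 v)) :=
    sigmaCompactSpace_of_locallyCompact_secondCountable
  haveI : SigmaCompactSpace ((cmDatum L 1 (Matrix.of fun i j : Fin 1 => if i.val + j.val + 1 = 1 then (1 : L) else 0)).Local v) :=
    sigmaCompactSpace_of_locallyCompact_secondCountable
  haveI : SigmaCompactSpace ((cmDatum L 2 (Matrix.of fun i j : Fin 2 => if i.val + j.val + 1 = 2 then (1 : L) else 0)).Local v) :=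
    sigmaCompactSpace_of_locallyCompact_secondCountable
  -- §1 the `U(Φ₂)`-principal series: admissible; `B₂`, `N₂` closed; `T₂` abelian
  have hadm : (cmPrincipalSeries L 2 v χ₂).IsAdmissible :=
    isAdmissible_cmPrincipalSeries_of_iwasawa L 2 v (exists_borel_mul_mem_cmLocalIntegralLevel L 2 v) _
  have hN : IsClosed (((cmBorelTriple L 2 v).N : Subgroup ↥(unitaryGroupOfForm (conjLocal L (IsCMField.complexConj L) v) (cmLocalForm L 2 v))) :
      Set ↥(unitaryGroupOfForm (conjLocal L (IsCMField.complexConj L) v) (cmLocalForm L 2 v))) :=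
    (isClosed_upperUnitriangular (n := 2) (R := LocalRing L v)).preimage continuous_subtype_val
  have hP : IsClosed (((cmBorelTriple L 2 v).P : Subgroup ↥(unitaryGroupOfForm (conjLocal L (IsCMField.complexConj L) v) (cmLocalForm L 2 v))) :
      Set ↥(unitaryGroupOfForm (conjLocal L (IsCMField.complexConj L) v) (cmLocalForm L 2 v))) :=
    isClosed_borelU (conjLocal L (IsCMField.complexConj L) v) (cmLocalForm L 2 v)
  have hbcomm : ∀ m ∈ (cmBorelTriple L 2 v).M, m * b = b * m := fun m hm =>
    congrArg Subtype.val (torusU_mul_comm _ _ ⟨m, hm⟩ ⟨b, hbM⟩)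
  -- §2 the `H`-shell is a product of a `U(Φ₂)`-shell and a coset of the abelian `U(Φ₁)_v`
  have hK₁comm : ∀ k ∈ K₁, k * z₁ = z₁ * k := fun k _ => F0P3cStCharTSCassHTrace.subgroup_gl_one_mul_comm _ k z₁
  have hshell : DoubleCoset.doubleCoset ((b, z₁) : ↥(unitaryGroupOfForm (conjLocal L (IsCMField.complexConj L) v) (cmLocalForm L 2 v)) × (cmDatum L 1 (Matrix.of fun i j : Fin 1 => if i.val + j.val + 1 = 1 then (1 : L) else 0)).Local v) (((𝓘₂.K n).prod K₁ : Subgroup (↥(unitaryGroupOfForm (conjLocal L (IsCMField.complexConj L) v) (cmLocalForm L 2 v)) × (cmDatum L 1 (Matrix.of fun i j : Fin 1 => if i.val + j.val + 1 = 1 then (1 : L) else 0)).Local v)) : Set (↥(unitaryGroupOfForm (conjLocal L (IsCMField.complexConj L) v) (cmLocalForm L 2 v)) × (cmDatum L 1 (Matrix.of fun i j : Fin 1 => if i.val + j.val + 1 = 1 then (1 : L) else 0)).Local v)) (((𝓘₂.K n).prod K₁ : Subgroup (↥(unitaryGroupOfForm (conjLocal L (IsCMField.complexConj L) v) (cmLocalForm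 L 2 v)) × (cmDatum L 1 (Matrix.of fun i j : Fin 1 => if i.val + j.val + 1 = 1 then (1 : L) else 0)).Local v)) : Set (↥(unitaryGroupOfForm (conjLocal L (IsCMField.complexConj L) v) (cmLocalForm L 2 v)) × (cmDatum L 1 (Matrix.of fun i j : Fin 1 => if i.val + j.val + 1 = 1 then (1 : L) else 0)).Local v)) =
      DoubleCoset.doubleCoset b (𝓘₂.K n : Set ↥(unitaryGroupOfForm (conjLocal L (IsCMField.complexConj L) v) (cmLocalForm L 2 v))) (𝓘₂.K n : Set ↥(unitaryGroupOfForm (conjLocal L (IsCMField.complexConj L) v) (cmLocalForm L 2 v))) ×ˢ (z₁ • (K₁ : Set ((cmDatum L 1 (Matrix.of fun i j : Fin 1 => if i.val + j.val + 1 = 1 then (1 : L) else 0)).Local v))) := by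
    rw [doubleCoset_prod, doubleCoset_eq_smul_of_forall_comm K₁ hK₁comm]
  rw [hshell]
  exact smoothTrace_boxChar_prodShell_eq_ite_of_normalizedTwoStep
    (G₁ := (cmDatum L 1 (Matrix.of fun i j : Fin 1 => if i.val + j.val + 1 = 1 then (1 : L) else 0)).Local v) hadm χ₁ hχ₁ ν₂ ν₁
    (cmBorelTriple L 2 v) hP hN 𝓘₂ n hfd h2 ℓ hℓ1 χa χ₂ hL hQ hiff hbM hbcomm hbN hbNbar hbexh hR₂ K₁ hK₁o hK₁c z₁

end CM

end Summit.HodgeConjecture.HodgeConjecture.Cruxes.H413.F0P3cStCharTSShellTracePSH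

end
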